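import Summits.CriticalPhenomena.CardyFormulaZ2.Theorems.CardyUniqueLimitCardyRigidityCapacityClockDefs
import Summits.CriticalPhenomena.CardyFormulaZ2.Theorems.CardyUniqueLimitCardyRigidityCapacityClockNonStall
import Summits.CriticalPhenomena.CardyFormulaZ2.Theorems.CardyUniqueLimitCardyRigiditySlitCrossingAugmentation
import Literature.Probability.RandomPlanarGeometry.LoewnerRegularBoxes
import HarnessLib

/-!
# The capacity clock of the bond-`ℤ²` exploration (horizon form): proof

Crux `Summit.CriticalPhenomena.CardyFormulaZ2.Theses.CardyUniqueLimit.CardyRigidity`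
(stmt-CriticalPhenomena-0746), line `crossing_martingale`, stub A3a.  PROOF of the horizon form
`PercCapacityClockH` of the capacity clock (`…CapacityClockDefs.lean`) from its own hypotheses
— Kemppainen–Smirnov box tightness, (U1), `b_k → b`, the orientation hypothesis:

* per scale (`CapacityClock.rep`, `CapacityClock.clock`, `…CapacityClockDefs.lean`): the clock
  `θ_n = min (T_n, t + 1)` — `T_n` the capacity time of the explored piece `γ[0, n+1]` through
  `φ_k`, read on a describable representative of the prefix class (a sure class function of the
  prefix: ADAPTED to the exploration filtration), frozen at `t + 1` when no capacity time exists;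
  the driving values `V_u`, `u ≤ θ_n`, are class functions of the prefix on the describable
  configurations, which have full measure by box tightness, so they are measurable for the
  AUGMENTED exploration filtration (`Augment.filtration`, whose conditional expectations are
  still the percolation slit expectations);
* per level `j`: off the box event of probability `≤ 1/(j+1)`, uniform non-stalling of the box
  curves (`capClock_exists_nonstall`), almost-injectivity of `Φ_k` ((U1),
  `CapacityClock.exists_almostInj`), uniform properness and the mesh `δ_k → 0` give
  `θ_0 ≤ 1/(j+1)` and increments `≤ 1/(j+1)` eventually in `k`
  (`CapacityClock.exists_capTime_zero`, `capClock_exists_capTime_succ`);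
* a diagonal choice of levels (`exists_rate_of_forall_eventually`) gives `Δ_k = η_k → 0`.
-/

noncomputable section

open MeasureTheory Filter Set Topology Metric
open scoped NNReal ENNReal unitInterval
open UpperHalfPlane (upperHalfPlaneSet)
open Literature.Probability Literature.Probability.RandomPlanarGeometry
  Literature.Probability.LatticeModels Literature.Probability.LatticeModels.DiscreteDobrushin
open Literature.Probability.Percolation (bondInterfaceIn BondConfig bondPercolation half
  measurable_bondInterfaceIn)
open Summit.CriticalPhenomena.CardyFormulaZ2.Cruxes.ParafermionToSLESixFamilies.CaratheodoryNetSlitUniformity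
  (percSlitExpectation)

namespace Summit.CriticalPhenomena.CardyFormulaZ2.Cruxes.CardyRigidity.CrossingMartingale

namespace CapacityClock

/-! ### A diagonal choice of levels -/

/-- **Diagonal choice of rates.** If for every level `j` the property `Q k (1/(j+1))` holds
eventually in `k`, then `Q k (r k)` holds eventually for some sequence `r k → 0`. [folklore] -/
theorem exists_rate_of_forall_eventually {Q : ℕ → ℝ≥0 → Prop}
    (h : ∀ j : ℕ, ∀ᶠ k in atTop, Q k (1 / ((j : ℝ≥0) + 1))) :
    ∃ r : ℕ → ℝ≥0, Tendsto r atTop (𝓝 0) ∧ ∀ᶠ k in atTop, Q k (r k) := by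
  classical
  choose N hN using fun j ↦ eventually_atTop.1 (h j)
  let J : ℕ → ℕ := fun k ↦ Nat.findGreatest (fun j ↦ ∀ i ≤ j, N i ≤ k) k
  have hJ : Tendsto J atTop atTop := by
    refine tendsto_atTop_atTop.2 fun j₀ ↦ ⟨max j₀ ((Finset.range (j₀ + 1)).sup N), fun k hk ↦ ?_⟩
    refine Nat.le_findGreatest ((le_max_left _ _).trans hk) fun i hi ↦ ?_
    exact (Finset.le_sup (f := N) (Finset.mem_range.2 (Nat.lt_succ_of_le hi))).trans
      ((le_max_right _ _).trans hk)
  refine ⟨fun k ↦ 1 / ((J k : ℝ≥0) + 1), ?_, ?_⟩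
  · rw [← NNReal.tendsto_coe]
    have := (tendsto_one_div_add_atTop_nhds_zero_nat (𝕜 := ℝ)).comp hJ
    refine this.congr fun k ↦ ?_
    simp [J]
  · refine eventually_atTop.2 ⟨N 0, fun k hk ↦ ?_⟩
    have hP : ∀ i ≤ J k, N i ≤ k :=
      Nat.findGreatest_spec (P := fun j ↦ ∀ i ≤ j, N i ≤ k) (Nat.zero_le k)
        (fun i hi ↦ by rw [Nat.le_zero.1 hi]; exact hk)
    exact hN (J k) k (hP (J k) le_rfl)

/-! ### The theorem -/

/-- **The capacity clock of the bond-`ℤ²` exploration, horizon form — PROVED** from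
Kemppainen–Smirnov box tightness, the convergence (U1) of the boundary extensions with
`b_k → b`, and the orientation hypothesis (see the module docstring for the construction).
[cite: KemppainenSmirnov2017, §3.5 and Thm. 1.5] [cite: DuminilCopinSmirnov2012Clay, Prop. 6.7] -/
theorem percCapacityClockH : PercCapacityClockH := by
  intro D E hEf φ hφ δs hδpos hδ0 hδadm hor Ds φs hφs hU1 hU2 hb hbox t
  set P : Measure (BondConfig (Site 2)) := bondPercolation (zdGraph 2) half with hP
  set L : ℝ≥0 := t + 1 with hL
  set Q : ℕ → ℝ≥0 → Prop := fun k r ↦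
    ∃ (𝒢 : Filtration ℕ (inferInstance : MeasurableSpace (BondConfig (Site 2))))
      (θ : ℕ → BondConfig (Site 2) → ℝ≥0) (Mk : ℕ) (bad : Set (BondConfig (Site 2))),
      (∀ g : BondConfig (Site 2) → ℝ, StronglyMeasurable g → (∀ ω, |g ω| ≤ 1) → ∀ n,
        (bondPercolation (zdGraph 2) half)[g|𝒢 n] =ᵐ[bondPercolation (zdGraph 2) half]
          percSlitExpectation (hδadm k) half n g) ∧
      Adapted 𝒢 θ ∧ (∀ ω, ω ∉ bad → θ 0 ω ≤ r) ∧
      (∀ u, Measurable[𝒢 Mk] fun ω ↦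
        -drivingFunction (φs k) (bondInterfaceIn D (E (δs k)) ω) u) ∧
      (∀ n u, Measurable[𝒢 n] ({ω | u ≤ θ n ω}.indicator fun ω ↦
        -drivingFunction (φs k) (bondInterfaceIn D (E (δs k)) ω) u)) ∧
      MeasurableSet bad ∧ bondPercolation (zdGraph 2) half bad ≤ r ∧
      (∀ ω, ω ∉ bad → ∃ n ≤ Mk, t ≤ θ n ω) ∧
      (∀ ω, ω ∉ bad → ∀ n, n < Mk → θ (n + 1) ω ≤ θ n ω + r) ∧
      (∀ ω, ω ∉ bad → IsLoewnerDescribable (φs k) (bondInterfaceIn D (E (δs k)) ω) ∧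
        ∀ n, n ≤ Mk → (θ n ω : ℝ) < t + 1 → (φs k).boundaryExtension ''
          (Loewner.trace (drivingFunction (φs k) (bondInterfaceIn D (E (δs k)) ω)) ''
            Icc 0 (θ n ω)) =
          range (polyline ((explorationPrefix (E (δs k)) n ω).map (medialPoint (E (δs k)).δ))))
    with hQ
  suffices main : ∀ j : ℕ, ∀ᶠ k in atTop, Q k (1 / ((j : ℝ≥0) + 1)) by
    obtain ⟨r, hr, hev⟩ := exists_rate_of_forall_eventually main
    exact ⟨r, r, hr, hr, hev⟩
  intro j
  -- the level-`j` box
  set r : ℝ≥0 := 1 / ((j : ℝ≥0) + 1) with hr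
  have hrpos : 0 < r := by positivity
  obtain ⟨δγ, δW, Tt, hδγ, hδW, hboxk⟩ := hbox (r : ℝ≥0∞) (ENNReal.coe_pos.2 hrpos)
  set 𝒦 : Set (C(ℝ≥0, ℂ) × C(ℝ≥0, ℝ)) := {p | p ∈ generatedPairs ∧
    p.1 ∈ Process.modulusSet ({0} : Set ℂ) δγ ∧ p.2 ∈ Process.modulusSet ({0} : Set ℝ) δW ∧
    ∀ (j : ℕ) (t : ℝ≥0), Tt j ≤ t → (j : ℝ) ≤ ‖p.1 t‖} with h𝒦def
  have h𝒦 : IsCompact 𝒦 := isCompact_pairBox hδγ hδW Tt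
  have hgen : 𝒦 ⊆ generatedPairs := fun p hp ↦ hp.1
  have htr : ∀ p ∈ 𝒦, Tendsto (fun u ↦ ‖p.1 u‖) atTop atTop := fun p hp ↦
    tendsto_atTop_atTop.2 fun b ↦ ⟨Tt ⌈b⌉₊, fun u hu ↦ (Nat.le_ceil b).trans (hp.2.2.2 _ u hu)⟩
  -- uniform radius, non-stalling, almost-injectivity, properness, mesh
  obtain ⟨R, hR⟩ := exists_forall_norm_apply_le_of_isCompact h𝒦 (L + r)
  obtain ⟨ρ, hρ, hNS⟩ := exists_nonstall h𝒦 hgen L hrpos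
  obtain ⟨m, hm, hAI⟩ := exists_almostInj (Φs := fun k ↦ (φs k).boundaryExtension) (hU1 R) hρ
  obtain ⟨ρ₁, hρ₁, hproper⟩ := exists_forall_le_dist_boundaryExtension_of_varying hφ hφs hU1 hb R
  have hmesh : ∀ᶠ k in atTop, δs k < min (m / 4) (ρ₁ / 2) :=
    hδ0.eventually (gt_mem_nhds (lt_min (by positivity) (by positivity)))
  filter_upwards [hor, hAI, hmesh] with k hork hAIk hmeshk
  -- notation at scale `k`
  have hork' : ∀ ω, bondInterfaceIn D (E (δs k)) ω = CurveClass.mk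
      ⟨polyline ((medialExploration (E (δs k)) ω).map (medialPoint (E (δs k)).δ))⟩ := hork
  have hδk : (E (δs k)).δ = δs k := hEf.δ_eq (δs k)
  have hδk0 : 0 ≤ (E (δs k)).δ := by rw [hδk]; exact (hδpos k).le
  have hδm : 4 * (E (δs k)).δ < m := by
    rw [hδk]; linarith [hmeshk.trans_le (min_le_left _ _)]
  have hδρ : 2 * (E (δs k)).δ < ρ₁ := by
    rw [hδk]; linarith [hmeshk.trans_le (min_le_right _ _)]
  set Mk : ℕ := (finite_innerCorners (hδadm k)).toFinset.card with hMk
  set θ : ℕ → BondConfig (Site 2) → ℝ≥0 := fun n ω ↦ clock D (E (δs k)) (φs k) L n ω with hθ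
  set bad : Set (BondConfig (Site 2)) := (bondInterfaceIn D (E (δs k))) ⁻¹'
    ((fun p ↦ compactifiedClass (φs k).boundaryExtension ((Ds k).pt 1) p.1) '' 𝒦)ᶜ with hbad
  set V : ℝ≥0 → BondConfig (Site 2) → ℝ := fun u ω ↦
    -drivingFunction (φs k) (bondInterfaceIn D (E (δs k)) ω) u with hV
  have hVm : ∀ u, Measurable (V u) := fun u ↦
    ((measurable_drivingFunction_apply (hφs k) u).comp (measurable_bondInterfaceIn D (E (δs k)))).neg
  -- off `bad`: the interface is a box pair pushed through `Φ_k`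
  have hgood : ∀ ω, ω ∉ bad → ∃ p ∈ 𝒦,
      IsLoewnerDescribable (φs k) (bondInterfaceIn D (E (δs k)) ω) ∧
      Loewner.trace (drivingFunction (φs k) (bondInterfaceIn D (E (δs k)) ω)) = p.1 := by
    intro ω hω
    simp only [hbad, mem_preimage, mem_compl_iff, not_not] at hω
    obtain ⟨p, hp, hpω⟩ := hω
    refine ⟨p, hp, ?_, ?_⟩
    · rw [← hpω]
      exact (isLoewnerDescribed_compactifiedClass (hφs k) hp.1 (htr p hp)).isLoewnerDescribable
    · rw [← hpω, drivingFunction_compactifiedClass (hφs k) hp.1 (htr p hp)]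
      exact Loewner.IsGeneratedByCurve.trace_eq_holds p.2.continuous hp.1
  -- describability is almost sure
  have hdesc_ae : ∀ᵐ ω ∂P, IsLoewnerDescribable (φs k) (bondInterfaceIn D (E (δs k)) ω) := by
    rw [ae_iff]
    refine le_antisymm (le_of_forall_gt_imp_ge_of_dense fun ε hε ↦ ?_) zero_le
    obtain ⟨δγ', δW', T', hδγ', hδW', hbox'⟩ := hbox ε hε
    refine (measure_mono fun ω hω ↦ ?_).trans (hbox' k)
    simp only [mem_preimage, mem_compl_iff]
    rintro ⟨p, hp, hpω⟩
    refine hω ?_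
    rw [← hpω]
    have htr' : Tendsto (fun u ↦ ‖p.1 u‖) atTop atTop :=
      tendsto_atTop_atTop.2 fun b ↦ ⟨T' ⌈b⌉₊, fun u hu ↦ (Nat.le_ceil b).trans (hp.2.2.2 _ u hu)⟩
    exact (isLoewnerDescribed_compactifiedClass (hφs k) hp.1 htr').isLoewnerDescribable
  refine ⟨Augment.filtration P (explorationFiltration (hδadm k)), θ, Mk, bad, ?_, ?_, ?_, ?_, ?_,
    ?_, ?_, ?_, ?_, ?_⟩
  · -- bridge
    intro g hg hg1 n
    have hgi : Integrable g P :=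
      Integrable.of_bound hg.aestronglyMeasurable 1 (ae_of_all _ fun ω ↦ by
        rw [Real.norm_eq_abs]; exact hg1 ω)
    exact (Augment.condExp_filtration_ae_eq (explorationFiltration (hδadm k)) hgi n).trans
      (bridge_explorationFiltration (hδadm k) g hg hg1 n)
  · -- adapted
    exact Augment.adapted_filtration (adapted_explorationFiltration_of_forall_mem fun n ω₀ ω hω ↦
      clock_eq_of_prefix_eq L (explorationPrefix_eq_of_mem_explorationCylinder hω))
  · -- small start
    intro ω hω
    obtain ⟨p, hp, hdω, htrace⟩ := hgood ω hω
    have hexp := isMedialExploration_of hork' (hφs k) hdω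
    obtain ⟨s, hs, s', hs', -, -, hfar⟩ := hNS p hp 0 zero_le
    obtain ⟨T₀, hT₀, hT₀r⟩ := exists_capTime_zero (hφs k) (described_of hork' hdω) hexp hδk0
      (R := R) (ρ := ρ) (m := m) (ρ₁ := ρ₁) (Δ := r)
      (fun u hu ↦ by rw [htrace]; exact hR p hp u (hu.trans le_add_self))
      ⟨s, by simpa using hs, s', by simpa using hs', by rw [htrace]; exact hfar⟩
      (hAIk) (hproper k) hδm hδρ
    calc θ 0 ω = min T₀ L := clock_eq_min hork' (hδadm k) (hφs k) L hdω hT₀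
      _ ≤ T₀ := min_le_left _ _
      _ ≤ r := hT₀r
  · -- everything is revealed by step `Mk`
    intro u
    have h := measurable_explorationFiltration_comp_medialExploration_card (hE := hδadm k)
      (g := fun l ↦ -drivingFunction (φs k)
        (CurveClass.mk ⟨polyline (l.map (medialPoint (E (δs k)).δ))⟩) u)
    have hfun : (fun ω ↦ -drivingFunction (φs k) (bondInterfaceIn D (E (δs k)) ω) u) =
        fun ω ↦ -drivingFunction (φs k) (CurveClass.mk ⟨polyline ((medialExploration (E (δs k)) ω).map
          (medialPoint (E (δs k)).δ))⟩) u := by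
      funext ω; rw [hork' ω]
    rw [hfun]
    exact h.mono (Augment.le_filtration _ _) le_rfl
  · -- locality
    intro n u
    have hθm : Measurable (θ n) :=
      (measurable_explorationFiltration_of_forall_mem (hD := hδadm k) fun ω₀ ω hω ↦
        clock_eq_of_prefix_eq L (explorationPrefix_eq_of_mem_explorationCylinder hω)).mono
        ((explorationFiltration (hδadm k)).le n) le_rfl
    have hf : Measurable ({ω | u ≤ θ n ω}.indicator (V u)) :=
      (hVm u).indicator (measurableSet_le measurable_const hθm)
    have hg : Measurable[explorationFiltration (hδadm k) n]
        ({ω | u ≤ θ n ω}.indicator fun ω ↦ V u (rep D (E (δs k)) (φs k) n ω)) :=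
      measurable_explorationFiltration_indicator_of_forall_mem (θ := θ)
        (V := fun u ω ↦ V u (rep D (E (δs k)) (φs k) n ω))
        (fun ω₀ ω hω ↦ clock_eq_of_prefix_eq L (explorationPrefix_eq_of_mem_explorationCylinder hω))
        (fun ω₀ ω hω u _ ↦ by
          simp only [hV, rep_eq_of_prefix_eq (explorationPrefix_eq_of_mem_explorationCylinder hω)]) u
    refine Augment.measurable_filtration_of_ae_eq hf hg ?_
    filter_upwards [hdesc_ae] with ω hω
    by_cases hu : u ≤ θ n ω
    · rw [indicator_of_mem (show ω ∈ {ω | u ≤ θ n ω} from hu),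
        indicator_of_mem (show ω ∈ {ω | u ≤ θ n ω} from hu)]
      simp only [hV]
      rw [drivingFunction_eq_rep hork' (hδadm k) (hφs k) L hω hu]
    · rw [indicator_of_notMem (show ω ∉ {ω | u ≤ θ n ω} from hu),
        indicator_of_notMem (show ω ∉ {ω | u ≤ θ n ω} from hu)]
  · -- `bad` is measurable
    obtain ⟨hcl, -, -⟩ := isClosed_image_pairBox_and_continuousOn_drivingPath (hφs k) hδγ hδW Tt
    exact (measurable_bondInterfaceIn D (E (δs k)) hcl.measurableSet).compl
  · -- `bad` is small
    exact hboxk k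
  · -- the horizon is reached by step `Mk`
    intro ω hω
    obtain ⟨p, hp, hdω, -⟩ := hgood ω hω
    refine ⟨Mk, le_rfl, ?_⟩
    change t ≤ clock D (E (δs k)) (φs k) L Mk ω
    rw [clock_card_eq hork' (hδadm k) (hφs k) L hdω]
    exact le_self_add
  · -- increments
    intro ω hω n _
    obtain ⟨p, hp, hdω, htrace⟩ := hgood ω hω
    have hexp := isMedialExploration_of hork' (hφs k) hdω
    have hθle : θ (n + 1) ω ≤ L := clock_le L (n + 1) ω
    by_cases hex : ∃ T : ℝ≥0, (φs k).boundaryExtension ''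
        (Loewner.trace (drivingFunction (φs k) (bondInterfaceIn D (E (δs k)) ω)) '' Icc 0 T) =
        range (polyline ((explorationPrefix (E (δs k)) n ω).map (medialPoint (E (δs k)).δ)))
    · obtain ⟨Tn, hTn⟩ := hex
      have hθn : θ n ω = min Tn L := clock_eq_min hork' (hδadm k) (hφs k) L hdω hTn
      rcases le_or_gt L Tn with hLT | hTL
      · rw [hθn, min_eq_right hLT]
        exact hθle.trans le_self_add
      · obtain ⟨T', hT', hT'le⟩ := exists_capTime_succ (hφs k) (described_of hork' hdω) hexp hδk0
          (R := R) (ρ := ρ) (m := m) (ρ₁ := ρ₁) (L := L) (Δ := r)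
          (fun u hu ↦ by rw [htrace]; exact hR p hp u hu)
          (fun T hT ↦ by rw [htrace]; exact hNS p hp T hT)
          hAIk (hproper k) hδm hδρ hTL.le hTn
        calc θ (n + 1) ω = min T' L := clock_eq_min hork' (hδadm k) (hφs k) L hdω hT'
          _ ≤ T' := min_le_left _ _
          _ ≤ Tn + r := hT'le
          _ = θ n ω + r := by rw [hθn, min_eq_left hTL.le]
    · have hθn : θ n ω = L := clock_eq_cap hork' (hδadm k) (hφs k) L hdω hex
      rw [hθn]
      exact hθle.trans le_self_add
  · -- identification below the cap
    intro ω hω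
    obtain ⟨p, hp, hdω, -⟩ := hgood ω hω
    refine ⟨hdω, fun n _ hlt ↦ hasCap_clock_of_lt hork' (hδadm k) (hφs k) L hdω ?_⟩
    have : ((clock D (E (δs k)) (φs k) L n ω : ℝ≥0) : ℝ) < (L : ℝ) := by
      rw [hL]; exact_mod_cast hlt
    exact_mod_cast this

end CapacityClock

/-- **STUB A3a in horizon form — PROVED**: the capacity clock of the bond-`ℤ²` exploration along
the Kemppainen–Smirnov data (`PercCapacityClockH`; to be registered as the corrected signature
of `stub_percCapacityClock`). [cite: KemppainenSmirnov2017, §3.5 and Thm. 1.5] -/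
theorem stub_percCapacityClock : PercCapacityClockH :=
  CapacityClock.percCapacityClockH

end Summit.CriticalPhenomena.CardyFormulaZ2.Cruxes.CardyRigidity.CrossingMartingale

end
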